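import Literature.AnabelianGeometry.EtaleTheta.Discharge.Sec4GaloisActionToy
import HarnessLib

/-!
# [EtTh] §4: the Galois-action toy, part 2 — the setting, a `1`-st root, its bi-Kummer root, and
# `¬ ∀ S, Prop43_iii` (FACT-LIST row F-1305 AS TYPED is a schema)

S. Mochizuki, *The étale theta function and its Frobenioid-theoretic manifestations*, Publ. RIMS **45**
(2009) [MochizukiEtTh2009], §4: Def 4.1 (PDF pp.86–87), Prop 4.2 (iii) p.88, Prop 4.3 (i)–(iii) pp.90–91.

abc-iut cell, block F, seat abc-iut-f-111 (tranche 111).  Sequel of `Discharge/Sec4GaloisActionToy.lean` (the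
toy's base `D = WithTerminal B(ℤ)`, divisor/rational-function data and tempered-Frobenioid interface `ToyGal.tf`;
see there for the design and honest limits).  This file (its `def`s are toy OBJECTS; no `Prop`-valued
definition, no named fact, no instance) builds over it:
* the §4 setting `ToyGal.S := BiKummerSetting.mk …` with FREE, TRIVIAL birational vocabulary
  (`O^×(A^birat) := 1`, `fracOf := 1`, trivial `Aut`-action; the `DisjointSupports` / `(N,H)`-saturation /
  base-Frobenius-pair slots `:= True`), `Π ↠ Aut_D(gen) = ℤ` := abc-iut-w5-d218's `zQuot`, `Π ↠ Aut_D(top) = 1`,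
  all base objects Galois, `A_⊙ := (top, 0)` — so `H_⊙ = Π` and `H_{A_N} = Aut_C(A_N)` (`HA_eq_top`);
* `A_N = B_N := (gen, 0)`, the base-identity pre-steps `s' = step 1 0`, `s'' = step 0 0` (rational functions
  `(1, 1, 0)`, `(1, 0, 0)`), the fraction-pair they form for the free `f = 1`, the lift `liftAut : ℤ → Aut_C(A_N)`
  through the zero section, the `1`-st root `nthRoot` (`α = β = id`, `G = 1`; Def 4.1 (ii)–(iv) REAL clauses
  checked: Frobenius-trivial, `μ_1`-saturated, pull-back morphism, `H_⊙`-ample, …);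
* the TRANSPORT `transport s : Aut_C(A_N) →* Aut_C(B_N)` along a pre-step ([FrdI] Def 1.3 (iii)(d) for the
  model: `ModelFrobenioid.exists_iso_comp_eq_of_div_eq` + `cancel_left_of_isIso_baseMap`, `Φ = ℚ_{≥0}`
  divisorial, `B` group-like), and the bi-Kummer root `biKummerRoot` with `s^triv := id`, `ident := id`,
  `s'^{gp} := transport s'`, `s''^{gp} := transport s''` (Prop 4.3 (i) data; every field REAL);
* `toAdd_unit_transport`: the constant `b` of the rational function of `transport (step a b) (liftAut t)` is `a`
  (the shear `t^*(1, a, b) = (1, a, a + b)`); hence **`not_forall_prop43_iii`**: at `t`,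
  `s'^{gp}(t) ≠ s''^{gp}(t)`, so `s'^{gp}(t)·s''^{gp}(t)⁻¹ ∉ μ_1(B_N) = 1` and the universal closure of
  abc-iut-L2-t3's typed `BiKummerSetting.Prop43_iii` is FALSE.  What fails is exactly what the free vocabulary
  drops: in print (and in abc-iut-L6-t12's `prop43_iii_of`, via the [FrdI] Thm 5.2 (ii) dictionary `toB`,
  `hfrac`, `haut`) `x = u_{s'}/u_{s''}` IS the `N`-th root `f_N` and `x^N = f|_{A_N}` is `H_{A_N}`-fixed; here
  `O^×(A^birat) := 1` carries no such information while `H_{A_N}` moves `x`.  Instance forms that DO hold: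
  `prop43_iii_of` (modulo the dictionary), `prop43_iii_mkOfModel` (canonical model), the `Toy`/`ToyCov` pipelines.
HONEST FRAMING: a statement about the TYPED interface (FACT-LIST row F-1305 is admissible per NAMED instance
only); it says nothing about print's Prop 4.3 (iii); no side taken on [IUTchIII] Cor. 3.12; typed ≠ proved.
-/

noncomputable section

namespace Literature.AnabelianGeometry.EtaleTheta

open CategoryTheory Opposite Literature.AlgebraicGeometry.Frobenioids
open scoped NNRat

namespace ToyGal

/-! ## The §4 setting with free (trivial) birational vocabulary -/

/-- `Π^tp_X ↠ G_K` of the toy: abc-iut-w5-d218's inhabitant of `OncePuncturedTemperedGroup ℚ̄` (it carries a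
surjection `Π ↠ ℤ`). [cite: MochizukiEtTh2009, Def 4.1 p.86] -/
def oncePunctured : SemiGraphs.OncePuncturedTemperedGroup Toy.Kbar :=
  (SemiGraphs.OncePuncturedTemperedGroup.nonempty_model_of_isAlgClosed Toy.Kbar).some

/-- Its underlying `TemperedArithmeticGroup`. [cite: MochizukiEtTh2009, Def 4.1 p.86] -/
abbrev temperedGroup : SemiGraphs.TemperedArithmeticGroup.{0} Toy.Kbar := oncePunctured.toTemperedArithmeticGroup

/-- `Π^tp_X ↠ Aut_D(Y)`: `zQuot : Π ↠ ℤ = Aut(gen)` on (copies of) `gen`, trivial on `top`.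
[cite: MochizukiEtTh2009, Def 4.1 p.87] -/
def galoisSurj : ∀ A : Base, True → (temperedGroup.Pi →* Aut A)
  | .of x, _ => (autOf x).comp oncePunctured.zQuot
  | .star, _ => 1

/-- `Π^tp_X ↠ Aut_D(Y)` is surjective. [cite: MochizukiEtTh2009, Def 4.1 p.87] -/
theorem galoisSurj_surjective : ∀ (A : Base) (h : True), Function.Surjective (galoisSurj A h)
  | .of x, _ => (autOf_surjective x).comp oncePunctured.zQuot_surjective
  | .star, _ => fun α => ⟨1, by rw [map_one]; exact (aut_top_eq_one α).symm⟩

/-- **The toy §4 setting**: the tempered-Frobenioid interface `tf` with the BIRATIONAL VOCABULARY FREE AND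
TRIVIAL (`O^×(A^birat) := 1`, `fracOf := 1`, trivial `Aut`-action; `DisjointSupports`, `(N,H)`-saturation,
base-Frobenius-pair slots `:= True`), `Π ↠ Aut_D(gen) = ℤ` via `zQuot`, all objects Galois, `A_⊙ := (top, 0)`.
[cite: MochizukiEtTh2009, Def 4.1 p.86] -/
def S : BiKummerSetting temperedGroup realified Base catVocab where
  tf := tf
  monoidType_eq := tf_monoidType
  isPerfect := tf_isPerfect
  DisjointSupports _ _ := True
  biratUnits _ := PUnit
  biratAut _ := 1
  restrictAlong _ _ := MulEquiv.refl _
  fracOf _ _ _ _ _ := PUnit.unit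
  IsGaloisObj _ := True
  galoisSurj := galoisSurj
  galoisSurj_surjective := galoisSurj_surjective
  IsNHSaturatedBsFld _ _ _ := True
  ArisesFromBaseFrobeniusPair _ _ _ := True
  Aodot := ModelFrobenioid.zeroObj _ _ _ top
  isFrobeniusTrivial_Aodot := ModelFrobenioid.isFrobeniusTrivial_zeroObj ratFnFunctor_isGroupLike _
  isGalois_Aodot := trivial

/-! ## The objects `A_N = B_N = (gen, 0)` and the two pre-steps -/

/-- `A_N = B_N := (gen, 0)`. [cite: MochizukiEtTh2009, Prop 4.2 p.88] -/
def AN : S.C := ModelFrobenioid.zeroObj _ _ _ gen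

/-- Pull-back on `Φ = ℚ_{≥0}` (constant) is the identity. [cite: MochizukiEtTh2009, Def 3.6 p.76] -/
theorem pull_Φ_eq {X Y : Base} (f : X ⟶ Y) (x : S.tf.divisorMonoid.obj (op Y)) :
    pull S.tf.divisorMonoid f x = x := Subtype.ext rfl

/-- `Φ` of the setting is objectwise divisorial. [cite: MochizukiEtTh2009, Def 3.6 p.77] -/
theorem S_divisorMonoid_isDivisorial : Objectwise (fun M _ => IsDivisorial M) S.tf.divisorMonoid :=
  divisorMonoid_isDivisorial

/-- `B` of the setting is objectwise group-like. [cite: MochizukiEtTh2009, Def 3.6 p.77] -/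
theorem S_ratFnFunctor_isGroupLike : Objectwise (fun M _ => IsGroupLike M) S.tf.ratFnFunctor :=
  ratFnFunctor_isGroupLike

/-- The divisor `𝔭 = 1 ∈ ℚ_{≥0} = Φ(gen)`. [cite: MochizukiEtTh2009, Def 4.1 p.86] -/
def pdiv : S.tf.divisorMonoid.obj (op AN.base) := ⟨Multiplicative.ofAdd (1 : ℚ≥0), trivial⟩

/-- The rational function with valuation `1` and constants `(a, b)`, as an element of `B(gen)`.
[cite: MochizukiEtTh2009, Def 3.6 p.77] -/
def ratFnOf (a b : ℤ) : S.tf.ratFnFunctor.obj (op AN.base) :=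
  ⟨((Multiplicative.ofAdd (1 : ℤ), (Multiplicative.ofAdd a, Multiplicative.ofAdd b)),
    Algebra.GrothendieckGroup.of pdiv), by
    change Toy.divHomQ (Multiplicative.ofAdd 1) = gpMap _ (Algebra.GrothendieckGroup.of pdiv)
    rw [Toy.divHomQ_ofAdd_one, gpMap_of]
    rfl⟩

/-- The base-identity pre-step `(1, id, 𝔭, (1, a, b)) : A_N → B_N`. [cite: MochizukiEtTh2009, Def 4.1 p.86] -/
def step (a b : ℤ) : AN ⟶ AN :=
  ModelFrobenioid.mkHom AN AN 1 (𝟙 _) pdiv (ratFnOf a b) (by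
    show (1 : Algebra.GrothendieckGroup (S.tf.divisorMonoid.obj (op AN.base))) ^ ((1 : ℕ+) : ℕ) *
        Algebra.GrothendieckGroup.of pdiv =
      pullGp S.tf.divisorMonoid (𝟙 AN.base) 1 * Algebra.GrothendieckGroup.of pdiv
    rw [one_pow, map_one])

/-- `step a b` is a pre-step. [cite: MochizukiEtTh2009, Def 4.1 p.86] -/
theorem isPreStep_step (a b : ℤ) : S.IsPreStep (step a b) :=
  ⟨rfl, show IsIso (𝟙 AN.base) from inferInstance⟩

/-- **Def 4.1 (i) at the toy**: `(s', s'') := (step 1 0, step 0 0)` is a fraction-pair for `f = 1 ∈ O^×(A_N^birat) = 1`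
(free vocabulary). [cite: MochizukiEtTh2009, Def 4.1 p.86] -/
def fractionPair : S.FractionPair (A := AN) PUnit.unit AN where
  num := step 1 0
  den := step 0 0
  isPreStep_num := isPreStep_step 1 0
  isPreStep_den := isPreStep_step 0 0
  base_eq := rfl
  frac_eq := rfl
  disjointSupports := trivial

/-! ## Lifting `Aut_D(gen)` to `Aut_C(A_N)` and the `1`-st root -/

/-- `liftAut : ℤ = Aut_D(gen) → Aut_C(A_N)`, through the zero section `(1, g, 0, 1)`.
[cite: MochizukiEtTh2009, Def 4.1 p.87] -/
def liftAut : Multiplicative ℤ →* Aut AN :=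
  ((ModelFrobenioid.zeroSection tf.divisorMonoid tf.ratFnFunctor tf.divBNatTrans).mapAut gen).comp
    (autOf (SingleObj.star _))

/-- `Base(liftAut g) = autOf g`. [cite: MochizukiEtTh2009, Def 4.1 p.87] -/
theorem autBase_liftAut (g : Multiplicative ℤ) : S.autBase AN (liftAut g) = autOf (SingleObj.star _) g :=
  Iso.ext rfl

/-- `H_{A_N} = Aut_C(A_N)`: `H_⊙ = Ker(Π → Aut_D(top)) = Π` surjects onto `Aut_D(gen)`.
[cite: MochizukiEtTh2009, Def 4.1 p.87] -/
theorem HA_eq_top : S.HA AN trivial = ⊤ := by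
  rw [eq_top_iff]
  intro σ _
  change S.autBase AN σ ∈ S.HAbs AN trivial
  obtain ⟨π, hπ⟩ := galoisSurj_surjective gen trivial (S.autBase AN σ)
  exact ⟨π, MonoidHom.mem_ker.2 (aut_top_eq_one _), hπ⟩

/-- `A_N` is `H_⊙`-ample: every element of `Aut_D(gen)` lifts (`liftAut`). [cite: MochizukiEtTh2009, Def 4.1 p.87] -/
theorem isAmple_AN : S.IsAmple AN :=
  ⟨trivial, fun β _ => by
    obtain ⟨g, rfl⟩ := autOf_surjective (SingleObj.star _) β
    exact ⟨liftAut g, autBase_liftAut g⟩⟩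

/-- `A_N` is `μ_1`-saturated (`μ_1 = 1`). [cite: MochizukiEtTh2009, Def 4.1 p.87] -/
theorem isMuSaturated_AN_one : S.IsMuSaturated AN 1 := by
  refine ⟨1, ⟨one_mem _, by rw [PNat.one_coe, pow_one]⟩, by rw [orderOf_one, PNat.one_coe], ?_⟩
  rintro τ ⟨-, hτ⟩
  rw [PNat.one_coe, pow_one] at hτ
  rw [hτ]
  exact one_mem _

/-- **Def 4.1 (iv) at the toy**: `id : A_N → A_N` is of base-Frobenius type with `G = 1`, `α' = α'' = id`
(`Gal(A_N^bs/A_N^bs) = 1`; (e) is the free slot). [cite: MochizukiEtTh2009, Def 4.1 p.87] -/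
def baseFrobeniusTypeDataId : S.BaseFrobeniusTypeData (𝟙 AN) where
  G := ⊥
  G_le := bot_le
  α₂ := 𝟙 _
  α₁ := 𝟙 _
  fac := Category.comp_id _
  isFrobeniusTrivial := ModelFrobenioid.isFrobeniusTrivial_zeroObj S_ratFnFunctor_isGroupLike _
  isGalois := trivial
  isMuSaturated := isMuSaturated_AN_one
  mapsIsomorphically := by
    refine ⟨fun σ hσ => ?_, fun σ hσ τ hτ _ => ?_, fun τ hτ => ⟨1, (⊥ : Subgroup (Aut AN)).one_mem, ?_⟩⟩
    · have hσ' : σ = 1 := hσ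
      subst hσ'
      rw [map_one]
      exact one_mem _
    · exact (show σ = 1 from hσ).trans (show τ = 1 from hτ).symm
    · have h : τ.hom ≫ ModelFrobenioid.baseMap (𝟙 AN) = ModelFrobenioid.baseMap (𝟙 AN) := hτ
      rw [ModelFrobenioid.baseMap_id, Category.comp_id] at h
      rw [map_one]
      exact (Iso.ext h).symm
  cond_c := ⟨rfl, ⟨ModelFrobenioid.isCoAngular S_ratFnFunctor_isGroupLike _, rfl⟩,
    show IsIso (𝟙 (ModelFrobenioid.base AN)) from inferInstance⟩
  cond_d := ModelFrobenioid.isPullbackMorphism_of S_divisorMonoid_isDivisorial S_ratFnFunctor_isGroupLike rfl rfl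
  cond_e := trivial

/-- **Prop 4.2 (iii) data at the toy**: the fraction-pair `(s', s'')` is its own `1`-st root (`A_1 = B_1 = A_N`,
`α = β = id`, free root `f_1 = 1`), for the trivial transport `pullFrac := id`. [cite: MochizukiEtTh2009, Prop 4.2 p.88] -/
def nthRoot : S.NthRoot (A := AN) PUnit.unit fractionPair 1 (fun {_} _ x => x) where
  AN := AN
  BN := AN
  α := 𝟙 _
  β := 𝟙 _
  root := PUnit.unit
  pair := fractionPair
  comm_num := by rw [Category.comp_id, Category.id_comp]
  comm_den := by rw [Category.comp_id, Category.id_comp]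
  isIsometry := ⟨ModelFrobenioid.isIsometry_id _, ModelFrobenioid.isIsometry_id _, rfl, rfl⟩
  αData := baseFrobeniusTypeDataId
  pow_root := rfl
  isSaturated :=
    { isAmple := isAmple_AN
      fixed := fun _ _ => rfl
      cond_a := ⟨AN, AN, 𝟙 _, 𝟙 _, ModelFrobenioid.isPreStep_id _, ModelFrobenioid.isPreStep_id _,
        ModelFrobenioid.isFrobeniusTrivial_zeroObj S_ratFnFunctor_isGroupLike _, trivial⟩
      cond_b := ⟨PUnit.unit, rfl⟩ }

/-! ## Transport of automorphisms along a base-identity pre-step -/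

/-- **[FrdI] Def 1.3 (iii)(d) at the toy, as a function**: along a pre-step `s : A_N → B_N` every
`σ ∈ Aut_C(A_N)` has a UNIQUE `σ' ∈ Aut_C(B_N)` with `σ' ∘ s = s ∘ σ` (existence:
`ModelFrobenioid.exists_iso_comp_eq_of_div_eq`, `Φ`-pull-backs being trivial and `Div` of automorphisms `0`;
uniqueness: total epimorphicity `cancel_left_of_isIso_baseMap`). [cite: MochizukiEtTh2009, Prop 4.3 p.90] -/
theorem existsUnique_transport {s : AN ⟶ AN} (hs : S.IsPreStep s) (σ : Aut AN) :
    ∃! σ' : Aut AN, s ≫ σ'.hom = σ.hom ≫ s := by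
  haveI : IsIso (ModelFrobenioid.baseMap s) := hs.2
  haveI := ModelFrobenioid.isIso_baseMap_of_isIso σ.hom
  haveI : IsIso (ModelFrobenioid.baseMap (σ.hom ≫ s)) := by
    change IsIso (ModelFrobenioid.baseMap σ.hom ≫ ModelFrobenioid.baseMap s)
    infer_instance
  have hdeg : ModelFrobenioid.degFr s = ModelFrobenioid.degFr (σ.hom ≫ s) := by
    rw [ModelFrobenioid.degFr_comp, ModelFrobenioid.degFr_eq_one_of_isIso σ.hom, mul_one]
  have hdiv : ModelFrobenioid.div s = ModelFrobenioid.div (σ.hom ≫ s) := by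
    rw [ModelFrobenioid.div_comp_pull, pull_Φ_eq,
      ModelFrobenioid.div_eq_one_of_isIso S_divisorMonoid_isDivisorial σ.hom, one_pow, mul_one]
  obtain ⟨v, hv⟩ := ModelFrobenioid.exists_iso_comp_eq_of_div_eq S_ratFnFunctor_isGroupLike s (σ.hom ≫ s) hdeg hdiv
  refine ⟨v, hv, fun v' hv' => ?_⟩
  apply Iso.ext
  exact ModelFrobenioid.cancel_left_of_isIso_baseMap S_divisorMonoid_isDivisorial S_ratFnFunctor_isGroupLike s
    (hv'.trans hv.symm)

/-- The transport `σ ↦ σ'` along a pre-step `s`, as a group homomorphism `Aut_C(A_N) → Aut_C(B_N)`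
(the "unique group homomorphisms" of Prop 4.3 (i) for `s^triv := id`). [cite: MochizukiEtTh2009, Prop 4.3 p.90] -/
def transport {s : AN ⟶ AN} (hs : S.IsPreStep s) : Aut AN →* Aut AN where
  toFun σ := (existsUnique_transport hs σ).choose
  map_one' := (existsUnique_transport hs 1).unique (existsUnique_transport hs 1).choose_spec.1
    (show s ≫ 𝟙 _ = 𝟙 _ ≫ s by rw [Category.comp_id, Category.id_comp])
  map_mul' σ τ := (existsUnique_transport hs (σ * τ)).unique (existsUnique_transport hs (σ * τ)).choose_spec.1 (by
    have hσ := (existsUnique_transport hs σ).choose_spec.1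
    have hτ := (existsUnique_transport hs τ).choose_spec.1
    rw [Aut.Aut_mul_def, Aut.Aut_mul_def, Iso.trans_hom, Iso.trans_hom, Category.assoc, reassoc_of% hτ, hσ])

/-- The defining relation of the transport: `transport s σ ∘ s = s ∘ σ`. [cite: MochizukiEtTh2009, Prop 4.3 p.90] -/
theorem transport_spec {s : AN ⟶ AN} (hs : S.IsPreStep s) (σ : Aut AN) :
    s ≫ (transport hs σ).hom = σ.hom ≫ s :=
  (existsUnique_transport hs σ).choose_spec.1


/-- **The bi-Kummer `1`-st root of the toy** (Prop 4.3 (i) data over `nthRoot`): `s^triv := id` on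
`H_{A_N} = Aut_C(A_N)` (a section over the base, trivially), identification `id`, and the two sections
`s'^{gp} := transport s'`, `s''^{gp} := transport s''`. [cite: MochizukiEtTh2009, Prop 4.3 p.90] -/
def biKummerRoot : S.BiKummerRoot (pullFrac := fun {_ _} _ x => x) nthRoot trivial trivial where
  striv := (S.HA AN trivial).subtype
  autBase_striv _ := rfl
  ident := MulEquiv.refl _
  autBase_ident h := by
    change 𝟙 _ ≫ S.base.map h.1.hom = S.base.map h.1.hom ≫ 𝟙 _
    rw [Category.id_comp, Category.comp_id]
  sNum := (transport (isPreStep_step 1 0)).comp (S.HA AN trivial).subtype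
  sDen := (transport (isPreStep_step 0 0)).comp (S.HA AN trivial).subtype
  comm_num h := transport_spec (isPreStep_step 1 0) h.1
  comm_den h := transport_spec (isPreStep_step 0 0) h.1

/-- The generator `t = 1 ∈ ℤ = Aut_D(gen)` lifted to `H_{B_N} = Aut_C(B_N)`. [cite: MochizukiEtTh2009, Def 4.1 p.87] -/
def hgen : S.HA AN trivial := ⟨liftAut (Multiplicative.ofAdd 1), by rw [HA_eq_top]; exact Subgroup.mem_top _⟩

/-- The rational function of the transported generator, read on the constant `b`: along `s'` it must be
`1`, along `s''` it must be `0`. [cite: MochizukiEtTh2009, Prop 4.3 p.91] -/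
theorem toAdd_unit_transport (a b : ℤ) :
    Multiplicative.toAdd (ModelFrobenioid.unit (transport (isPreStep_step a b) (liftAut (Multiplicative.ofAdd 1))).hom).1.1.2.2
      = a := by
  set σ := transport (isPreStep_step a b) (liftAut (Multiplicative.ofAdd 1)) with hσ
  have E := congrArg ModelFrobenioid.unit (transport_spec (isPreStep_step a b) (liftAut (Multiplicative.ofAdd 1)))
  rw [ModelFrobenioid.unit_comp_pull, ModelFrobenioid.unit_comp_pull, ModelFrobenioid.degFr_eq_one_of_isIso σ.hom,
    show ModelFrobenioid.degFr (step a b) = 1 from rfl, PNat.one_coe, pow_one, pow_one,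
    show ModelFrobenioid.unit (liftAut (Multiplicative.ofAdd 1)).hom = 1 from rfl, mul_one,
    show ModelFrobenioid.baseMap (step a b) = 𝟙 _ from rfl, pull_id] at E
  have E' := congrArg (fun u : S.tf.ratFnFunctor.obj (op AN.base) => Multiplicative.toAdd u.1.1.2.2) E
  change Multiplicative.toAdd ((ModelFrobenioid.unit σ.hom).1.1.2.2 * Multiplicative.ofAdd b) =
    Multiplicative.toAdd (Multiplicative.ofAdd (a : ℤ) ^ Multiplicative.toAdd (Multiplicative.ofAdd (1 : ℤ)) *
      Multiplicative.ofAdd b) at E'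
  rw [toAdd_mul, toAdd_mul, toAdd_ofAdd, toAdd_ofAdd, toAdd_zpow, toAdd_ofAdd, one_smul] at E'
  omega

/-- **[EtTh] Prop 4.3 (iii) AS TYPED is a schema, not a fact: its universal closure is FALSE.**  At the toy
setting `ToyGal.S` (free birational vocabulary; base with the Galois object `gen`, `Aut(gen) = ℤ` acting on the
constants of `B` by a shear) the bi-Kummer `1`-st root `biKummerRoot` has `s'^{gp}(t) · s''^{gp}(t)⁻¹ ≠ 1`
(its rational function is `t^* x / x = (0, 0, 1)`, `x = u_{s'}/u_{s''}`), so it is not in `μ_1(B_N) = 1`.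
Hence `Prop43_iii` is NOT a consequence of the `BiKummerSetting` axioms: the [FrdI] Thm 5.2 (ii) dictionary
hypotheses (`toB`, `hfrac`, `haut`) of abc-iut-L6-t12's `prop43_iii_of` — which tie `f_N`, `f|_{A_N}` to the
actual rational functions — are exactly what is needed (and hold for `mkOfModel`, `prop43_iii_mkOfModel`).
FACT-LIST row F-1305 (abc-iut-f-111): admissible per NAMED instance only.
[cite: MochizukiEtTh2009, Prop 4.3 (iii) p.91] -/
theorem not_forall_prop43_iii :
    ¬ ∀ {K : Type} [Field K] {X : SemiGraphs.TemperedArithmeticGroup.{0} K} {D₀ : Type} [Category.{0} D₀]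
        {V : FrdIMonoidStub.{0}} {T : RealifiedDivisorMonoids (D₀ := D₀) V} {D : Type} [Category.{0} D]
        {VD : FrdICatStub.{0, 0, 0} D} (S : BiKummerSetting X T D VD)
        (pullFrac : ∀ {A A' : S.C} (_ : A' ⟶ A), S.biratUnits A → S.biratUnits A'),
        Literature.AnabelianGeometry.EtaleTheta.BiKummerSetting.Prop43_iii S pullFrac := by
  intro h
  have hmu := h S (fun {_ _} _ x => x) nthRoot trivial trivial biKummerRoot hgen
  have heq : transport (isPreStep_step 1 0) (liftAut (Multiplicative.ofAdd 1)) =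
      transport (isPreStep_step 0 0) (liftAut (Multiplicative.ofAdd 1)) := by
    have h2 := hmu.2
    rw [PNat.one_coe, pow_one, mul_inv_eq_one] at h2
    exact h2
  have h1 := toAdd_unit_transport 1 0
  have h0 := toAdd_unit_transport 0 0
  rw [heq] at h1
  rw [h1] at h0
  exact one_ne_zero h0

end ToyGal

end Literature.AnabelianGeometry.EtaleTheta

end
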